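import Summits.NavierStokesRegularity.FunctionalMining.NoGo.TopEigHeatLaminateWirtinger
import Literature.Analysis.FluidPDE.PlanarCircleWirtinger
import HarnessLib

/-!
# NO-GO K40b — the WHOLE `x₂`-laminate class at the rate `16π²(q−1)/q`, CONDITIONALLY on ONE scalar input:
# the constrained Wirtinger inequality (typed here as `ConstrainedWirtinger q`; a theorem in print, see below)

search for candidate a priori estimates; no regularity claim.

Cell `pub-nsfunc` (NS FUNCTIONAL MINING), NOGO seat (gen 48); a typed escape door of node K6 / door (c)
(the witness class of L-λ(q), `@[conjecture] TopEig.TopEigHeatCoercivePos q`; static heat line, no transport,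
no pressure). Nothing about Navier–Stokes is proved or asserted here.
K37b proved the laminate rate `4π²(q−1)/q` for every real `q > 1` (Dirichlet–Poincaré at ONE zero of `F′`; the
sharp laminate value at `q = 2` is `8π²`, four times K37b's). THIS FILE isolates what the remaining factor `4`
costs: exactly the scalar inequality `ConstrainedWirtinger q` — for every `C¹` `1`-periodic `u : ℝ → ℝ` with
`∫₀¹ (u²)^{1/q−1/2}·u = 0` (i.e. `∫₀¹ |u|^{2/q−1}u = 0`): `4π² ∫₀¹ u² ≤ ∫₀¹ u′²` — a `def … : Prop` used ONLY as
a hypothesis in THIS file and proved here only at `q = 2`; it is PROVED FOR EVERY `q > 0` in the sequel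
`NoGo/TopEigHeatLaminateUnconditional` (tool files `NoGo/HalfShiftWirtingerEngine`, `NoGo/HalfShiftWirtinger`: the
lit seat's elementary HALF-SHIFT proof — an odd increasing constraint forces an antipodal zero `u(y₀) + u(y₀+½) =
0`, and the half-periodic / half-antiperiodic parts of `u` each obey Wirtinger with the same constant), which makes
every result below unconditional. In print: for `1 ≤ q ≤ 2` the hypothesis is Croce–Dacorogna,
*On a generalized Wirtinger inequality*, Discrete Contin. Dyn. Syst. 9 (2003) 1329–1341, Thm 1.1 (periodic
`W^{1,2}` class; `p = q = 2`, `r = 1 + 2/q ∈ [2, 3]`; `α(2,2,r) = α(2,2,2) = π` on a period of length `2`; `r = 2`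
is the classical Wirtinger inequality; Dacorogna–Gangbo–Subía, Ann. IHP Anal. Non Linéaire 9 (1992) 29–50 for a
sub-range); for `q > 2` (`1 < r < 2`) we found no verbatim periodic statement in print (derivable from
Ghisi–Gobbino–Rovellini, ESAIM Control Optim. Calc. Var. (2018), doi:10.1051/cocv/2017059, Thm 1, plus periodic
rearrangement — a pen route superseded by the sequel's kernel proof). Results (§§5–6; `1 < q`, every smooth
`1`-periodic `F`, both
one-sided cores `Φ_q ∈ {∫(λ₁⁺)^q, ∫((−λ₃)⁺)^q}`): `laminate_coercive_of_constrainedWirtinger`, the class form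
`heatCoerciveOn_laminate_of_constrainedWirtinger : ConstrainedWirtinger q → HeatCoerciveOn IsX2Laminate Φ_q
(16π²(q−1)/q)`, the kill form, and `constrainedWirtinger_two : ConstrainedWirtinger 2` PROVED (classical
Wirtinger, tree `Literature.Analysis.FluidPDE.wirtinger_interval_real`; at `q = 2` the chain re-derives the sharp
tree value `8π²` of `TopEigLaminateTwo.laminate_rigid_two` — consistency of the typing).
Method. K37b's regularised chain (`η > 0`, `H_η = (F′²+η²)^{(q−2)/4}F′`, `H_η′² ≤ (q²/(4(q−1)))φ_η′(F′)F″²`, one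
integration by parts) with the Dirichlet–Poincaré step replaced by `ConstrainedWirtinger q` applied to the SHIFTED
function `H_η + m_η`: the power mean `powMean F q η m = ∫₀¹((H_η+m)²)^{1/q−1/2}(H_η+m)` is continuous in `η` and
in `m`, strictly increasing in `m` (`sqPow_strictMono`) and vanishes at `η = m = 0` (`sqPow_sqPow_self`: it equals
`∫₀¹F′ = 0`), so for every `ε > 0` and all small `η` a root `m_η` with `|m_η| ≤ ε` exists (`exists_small_root`,
intermediate value theorem); pointwise `(H_η+m_η)² ≥ (1−ε)H_η² − ε`; then `η → 0⁺` and `ε → 0⁺` by continuity of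
the two parametric integrals of K37b. Kernel-checked; the ONLY input not proved in this file is the displayed
hypothesis, discharged in the sequel: with it the laminate door of L-λ(q) closes at `16π²(q−1)/q` for every real
`q > 1`, sharp only at `q = 2` (`8π²`). L-λ(q) itself stays OPEN in the kernel for every real `q > 1`. [ours]
search for candidate a priori estimates; no regularity claim.
FILING (prove seat g29, REQUEST #62): declarations byte-identical to the no-go seat's staged `TopEigHeatLaminateConstrained.STAGING.lean` 8bb223136c605bce; this line is the only addition (cut from the v5 re-tag).
-/

noncomputable section

open MeasureTheory Set intervalIntegral Real Filter
open scoped Topology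

namespace Summit.NavierStokesRegularity.FunctionalMining

open Literature.Analysis Literature.Analysis.FunctionSpaces Literature.Analysis.FunctionSpaces.Torus
open TopEig LaminateDirection

namespace TopEigLaminate

/-! ## 1. The typed input: the constrained Wirtinger inequality -/

/-- **The constrained Wirtinger inequality with exponent `q`** (a HYPOTHESIS of this file, proved here only at
`q = 2`; proved for every `q > 0` in the sequel `NoGo/TopEigHeatLaminateUnconditional`): every `C¹` `1`-periodic `u`
with the power-mean constraint `∫₀¹ (u²)^{1/q−1/2}u = 0` (`= ∫₀¹|u|^{2/q−1}u`) satisfies `4π²∫₀¹u² ≤ ∫₀¹u′²`. In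
print for `1 ≤ q ≤ 2` (Croce–Dacorogna 2003, Thm 1.1, `p = q = 2`, `r = 1 + 2/q`); typed by us.
[cite: CroceDacorogna2003, Thm 1.1] -/
def ConstrainedWirtinger (q : ℝ) : Prop :=
  ∀ (u u' : ℝ → ℝ), (∀ x, HasDerivAt u (u' x) x) → Continuous u' → Function.Periodic u 1 →
    ∫ x in (0 : ℝ)..1, (u x ^ 2) ^ (1 / q - 1 / 2) * u x = 0 →
      4 * π ^ 2 * ∫ x in (0 : ℝ)..1, u x ^ 2 ≤ ∫ x in (0 : ℝ)..1, u' x ^ 2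

/-! ## 2. The odd power nonlinearity `t ↦ (t²)^r·t` -/

/-- **`t ↦ (t²)^r·t = |t|^{2r}t` is strictly increasing** for `r > −1/2`. [folklore] -/
theorem sqPow_strictMono {r : ℝ} (hr : -1 / 2 < r) : StrictMono fun t : ℝ => (t ^ 2) ^ r * t := by
  have he : 0 < 2 * r + 1 := by linarith
  have hpos : ∀ {y : ℝ}, 0 < y → (y ^ 2) ^ r * y = y ^ (2 * r + 1) := fun {y} hy => by
    rw [sq_rpow_eq_abs_rpow, abs_of_pos hy, rpow_add hy, rpow_one]
  have hIci : StrictMonoOn (fun t : ℝ => (t ^ 2) ^ r * t) (Ici 0) := by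
    intro x hx y _ hxy
    have hx' : 0 ≤ x := Set.mem_Ici.1 hx
    have hy : 0 < y := lt_of_le_of_lt hx' hxy
    rcases hx'.eq_or_lt with h0 | hx0
    · rw [← h0]
      simpa only [mul_zero] using mul_pos (rpow_pos_of_pos (by positivity) r) hy
    · simp only [hpos hx0, hpos hy]
      exact rpow_lt_rpow hx0.le hxy he
  have hIic : StrictMonoOn (fun t : ℝ => (t ^ 2) ^ r * t) (Iic 0) := by
    intro x hx y hy hxy
    have h := hIci (Set.mem_Ici.2 (neg_nonneg.2 (Set.mem_Iic.1 hy))) (Set.mem_Ici.2 (neg_nonneg.2 (Set.mem_Iic.1 hx)))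
      (neg_lt_neg hxy)
    simpa only [neg_sq, mul_neg, neg_lt_neg_iff] using h
  exact hIic.Iic_union_Ici hIci

/-- **`t ↦ (t²)^{1/q−1/2}t` inverts `x ↦ (x²)^{(q−2)/4}x`** (`q ≠ 0`): `((H²)^{1/q−1/2})·H = x` for
`H = (x²)^{(q−2)/4}x` (`|x|^{1−q/2}·|x|^{(q−2)/2}·x = x`). [folklore; bookkeeping] -/
theorem sqPow_sqPow_self {q : ℝ} (hq : q ≠ 0) (x : ℝ) :
    (((x ^ 2) ^ ((q - 2) / 4) * x) ^ 2) ^ (1 / q - 1 / 2) * ((x ^ 2) ^ ((q - 2) / 4) * x) = x := by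
  rcases eq_or_ne x 0 with rfl | hx
  · simp
  have ha : 0 < |x| := abs_pos.2 hx
  rw [sq_rpow_eq_abs_rpow (((x ^ 2) ^ ((q - 2) / 4) * x)), abs_mul, sq_rpow_eq_abs_rpow x,
    abs_of_nonneg (rpow_nonneg ha.le _), mul_rpow (rpow_nonneg ha.le _) ha.le, ← rpow_mul ha.le, ← mul_assoc,
    ← rpow_add ha, ← rpow_add ha]
  have he : 2 * ((q - 2) / 4) * (2 * (1 / q - 1 / 2)) + 2 * (1 / q - 1 / 2) + 2 * ((q - 2) / 4) = 0 := by
    field_simp; ring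
  rw [he, rpow_zero, one_mul]

variable (F : ShearProfile)

/-! ## 3. The power mean of the shifted comparison function and its small root -/

/-- The integrand `((H_η(x) + m)²)^{1/q−1/2}(H_η(x) + m)`, `H_η = (F′²+η²)^{(q−2)/4}F′`. [ours; bookkeeping] -/
def powMeanIntegrand (q η m x : ℝ) : ℝ :=
  (((F.D x ^ 2 + η ^ 2) ^ ((q - 2) / 4) * F.D x + m) ^ 2) ^ (1 / q - 1 / 2) *
    ((F.D x ^ 2 + η ^ 2) ^ ((q - 2) / 4) * F.D x + m)

/-- **The power mean** `powMean F q η m = ∫₀¹ ((H_η + m)²)^{1/q−1/2}(H_η + m)`: the constraint functional of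
`ConstrainedWirtinger q` evaluated at the shifted comparison function `H_η + m`. [ours; bookkeeping] -/
def powMean (q η m : ℝ) : ℝ :=
  ∫ x in (0 : ℝ)..1, powMeanIntegrand F q η m x

/-- Continuity of the integrand in `(η, x)`, in `(m, x)` and in `x` (`q > 1`; K37a tools). [ours; bookkeeping] -/
theorem continuous_powMeanIntegrand {q : ℝ} (hq : 1 < q) (η m : ℝ) :
    (Continuous fun p : ℝ × ℝ => powMeanIntegrand F q p.1 m p.2) ∧
      (Continuous fun p : ℝ × ℝ => powMeanIntegrand F q η p.1 p.2) ∧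
        Continuous fun x : ℝ => powMeanIntegrand F q η m x := by
  have h1 := F.D.continuous
  have hq0 : 0 < q := by linarith
  have hb : -1 / 2 < (q - 2) / 4 := by linarith
  have hr : -1 / 2 < 1 / q - 1 / 2 := by have := one_div_pos.2 hq0; linarith
  unfold powMeanIntegrand
  refine ⟨?_, ?_, ?_⟩
  · have hH : Continuous fun p : ℝ × ℝ => (F.D p.2 ^ 2 + p.1 ^ 2) ^ ((q - 2) / 4) * F.D p.2 + m :=
      ((continuous_sqReg_mul hb).comp (continuous_fst.prodMk (h1.comp continuous_snd))).add continuous_const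
    exact (continuous_sqPow_mul hr).comp hH
  · have hH : Continuous fun p : ℝ × ℝ => (F.D p.2 ^ 2 + η ^ 2) ^ ((q - 2) / 4) * F.D p.2 + p.1 :=
      ((continuous_sqReg_mul hb).comp (continuous_const.prodMk (h1.comp continuous_snd))).add continuous_fst
    exact (continuous_sqPow_mul hr).comp hH
  · have hH : Continuous fun x : ℝ => (F.D x ^ 2 + η ^ 2) ^ ((q - 2) / 4) * F.D x + m :=
      ((continuous_sqReg_mul hb).comp (continuous_const.prodMk h1)).add continuous_const
    exact (continuous_sqPow_mul hr).comp hH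

/-- `η ↦ powMean F q η m` is continuous (`q > 1`). [ours; bookkeeping] -/
theorem continuous_powMean_left {q : ℝ} (hq : 1 < q) (m : ℝ) : Continuous fun η : ℝ => powMean F q η m := by
  unfold powMean
  exact intervalIntegral.continuous_parametric_intervalIntegral_of_continuous'
    (f := fun (η x : ℝ) => powMeanIntegrand F q η m x) (continuous_powMeanIntegrand F hq 0 m).1 0 1

/-- `m ↦ powMean F q η m` is continuous (`q > 1`). [ours; bookkeeping] -/
theorem continuous_powMean_right {q : ℝ} (hq : 1 < q) (η : ℝ) : Continuous fun m : ℝ => powMean F q η m := by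
  unfold powMean
  exact intervalIntegral.continuous_parametric_intervalIntegral_of_continuous'
    (f := fun (m x : ℝ) => powMeanIntegrand F q η m x) (continuous_powMeanIntegrand F hq η 0).2.1 0 1

/-- **At `η = 0`, `m = 0` the power mean is `∫₀¹F′ = F(1) − F(0) = 0`.** [ours] -/
theorem powMean_zero_zero {q : ℝ} (hq : 1 < q) : powMean F q 0 0 = 0 := by
  have hq0 : q ≠ 0 := by linarith
  have e : powMean F q 0 0 = ∫ x in (0 : ℝ)..1, F.D x := by
    unfold powMean
    refine intervalIntegral.integral_congr fun x _ => ?_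
    simp only [powMeanIntegrand, ne_eq, OfNat.ofNat_ne_zero, not_false_eq_true, zero_pow, add_zero]
    exact sqPow_sqPow_self hq0 (F.D x)
  rw [e, intervalIntegral.integral_eq_sub_of_hasDerivAt (fun x _ => hasDerivAt_D F x)
    (F.D.continuous.intervalIntegrable 0 1)]
  simpa [sub_eq_zero] using F.periodic 0

/-- **The power mean is strictly increasing in the shift `m`** (the nonlinearity is, pointwise). [ours] -/
theorem powMean_strictMono {q : ℝ} (hq : 1 < q) (η : ℝ) : StrictMono fun m : ℝ => powMean F q η m := by
  have hq0 : 0 < q := by linarith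
  have hr : -1 / 2 < 1 / q - 1 / 2 := by have := one_div_pos.2 hq0; linarith
  have hmono := sqPow_strictMono hr
  have hc : ∀ m : ℝ, Continuous fun x : ℝ => powMeanIntegrand F q η m x := fun m =>
    (continuous_powMeanIntegrand F hq η m).2.2
  intro m m' hmm'
  have hlt : ∀ x : ℝ, powMeanIntegrand F q η m x < powMeanIntegrand F q η m' x := fun x => by
    unfold powMeanIntegrand
    exact hmono (by linarith)
  have hsub : powMean F q η m' - powMean F q η m =
      ∫ x in (0 : ℝ)..1, (powMeanIntegrand F q η m' x - powMeanIntegrand F q η m x) := by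
    unfold powMean
    rw [intervalIntegral.integral_sub ((hc m').intervalIntegrable 0 1) ((hc m).intervalIntegrable 0 1)]
  have hpos : 0 < ∫ x in (0 : ℝ)..1, (powMeanIntegrand F q η m' x - powMeanIntegrand F q η m x) :=
    intervalIntegral.intervalIntegral_pos_of_pos_on (((hc m').sub (hc m)).intervalIntegrable 0 1)
      (fun x _ => sub_pos.2 (hlt x)) zero_lt_one
  show powMean F q η m < powMean F q η m'
  linarith

/-- **Strict signs at `η = 0`**: `powMean F q 0 ε > 0 > powMean F q 0 (−ε)` for `ε > 0`. [ours] -/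
theorem powMean_zero_sign {q : ℝ} (hq : 1 < q) {ε : ℝ} (hε : 0 < ε) :
    0 < powMean F q 0 ε ∧ powMean F q 0 (-ε) < 0 := by
  have h1 := powMean_strictMono F hq 0 hε
  have h2 := powMean_strictMono F hq 0 (neg_lt_zero.2 hε)
  exact ⟨by simpa only [powMean_zero_zero F hq] using h1, by simpa only [powMean_zero_zero F hq] using h2⟩

/-- **A small root for all small `η`**: for every `ε > 0` there is `η₀ > 0` such that for `|η| < η₀` the power
mean `m ↦ powMean F q η m` has a zero with `|m| ≤ ε` (the strict signs persist for small `η`; IVT in `m`). [ours] -/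
theorem exists_small_root {q : ℝ} (hq : 1 < q) {ε : ℝ} (hε : 0 < ε) :
    ∃ η₀ : ℝ, 0 < η₀ ∧ ∀ η : ℝ, |η| < η₀ → ∃ m : ℝ, |m| ≤ ε ∧ powMean F q η m = 0 := by
  obtain ⟨hpos, hneg⟩ := powMean_zero_sign F hq hε
  have h1 : ∀ᶠ η in 𝓝 (0 : ℝ), 0 < powMean F q η ε :=
    ((continuous_powMean_left F hq ε).tendsto 0).eventually_const_lt hpos
  have h2 : ∀ᶠ η in 𝓝 (0 : ℝ), powMean F q η (-ε) < 0 :=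
    ((continuous_powMean_left F hq (-ε)).tendsto 0).eventually_lt_const hneg
  obtain ⟨η₀, hη₀, h⟩ := Metric.eventually_nhds_iff.1 (h1.and h2)
  refine ⟨η₀, hη₀, fun η hη => ?_⟩
  obtain ⟨ha, hb⟩ := h (by rwa [Real.dist_eq, sub_zero] : dist η 0 < η₀)
  have hIVT := intermediate_value_Icc (show -ε ≤ ε by linarith) (continuous_powMean_right F hq η).continuousOn
  obtain ⟨m, hm, hm0⟩ := hIVT ⟨hb.le, ha.le⟩
  exact ⟨m, abs_le.2 ⟨hm.1, hm.2⟩, hm0⟩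

/-! ## 4. The regularised chain with the constrained Wirtinger step, and the two limits -/

/-- **The limit `η → 0⁺` from a neighbourhood**: if `B` is continuous at `0` and `A ≤ B η` for `0 < η < η₀`, then
`A ≤ B 0` (K11d `const_le_of_forall_pos_le` with `η₀` in place of `1`). [folklore; bookkeeping] -/
theorem le_of_forall_small_pos {A : ℝ} {B : ℝ → ℝ} (hB : ContinuousAt B 0) {η₀ : ℝ} (hη₀ : 0 < η₀)
    (h : ∀ η : ℝ, 0 < η → η < η₀ → A ≤ B η) : A ≤ B 0 := by
  have ht : Tendsto B (𝓝[>] 0) (𝓝 (B 0)) := hB.tendsto.mono_left nhdsWithin_le_nhds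
  refine ge_of_tendsto ht ?_
  filter_upwards [Ioo_mem_nhdsGT hη₀] with η hη using h η hη.1 hη.2

/-- **The regularised laminate inequality under `ConstrainedWirtinger q`** (`q > 1`, `ε > 0`): for all small
`η > 0`, `4π²((1−ε)∫₀¹(F′²+η²)^{(q−2)/2}F′² − ε) ≤ (q/(4(q−1)))·(−regPairing F q η 0)`: the hypothesis applied
to `u = H_η + m_η` (`exists_small_root`); pointwise `(H_η+m_η)² ≥ (1−ε)H_η² − ε` and K37a `reg_deriv_sq_le`; one
integration by parts (K37b `regPairing_eq_neg_integral`). [ours] -/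
theorem reg_laminate_coercive_of_constrainedWirtinger {q : ℝ} (hCW : ConstrainedWirtinger q) (hq : 1 < q)
    {ε : ℝ} (hε : 0 < ε) :
    ∃ η₀ : ℝ, 0 < η₀ ∧ ∀ η : ℝ, 0 < η → η < η₀ →
      4 * π ^ 2 * ((1 - ε) * (∫ s in (0 : ℝ)..1, (F.D s ^ 2 + η ^ 2) ^ ((q - 2) / 2) * F.D s ^ 2) - ε) ≤
        q / (4 * (q - 1)) * -regPairing F q η 0 := by
  obtain ⟨η₀, hη₀, hroot⟩ := exists_small_root F hq hε
  refine ⟨η₀, hη₀, fun η hη hηη₀ => ?_⟩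
  obtain ⟨m, hmε, hm0⟩ := hroot η (by rwa [abs_of_pos hη])
  have h1 := F.D.continuous
  have h2 := F.D.D.continuous
  have hq0 : (0 : ℝ) < q := by linarith
  have hw : ∀ s : ℝ, 0 < F.D s ^ 2 + η ^ 2 := fun s => add_pos_of_nonneg_of_pos (sq_nonneg _) (by positivity)
  have hH : ∀ x, HasDerivAt (fun s : ℝ => (F.D s ^ 2 + η ^ 2) ^ ((q - 2) / 4) * F.D s + m)
      ((F.D x ^ 2 + η ^ 2) ^ ((q - 2) / 4 - 1) * ((2 * ((q - 2) / 4) + 1) * F.D x ^ 2 + η ^ 2) * F.D.D x) x :=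
    fun x => ((hasDerivAt_sqReg_mul ((q - 2) / 4) hη.ne' (F.D x)).comp x (hasDerivAt_D F.D x)).add_const m
  have hH'c : Continuous fun x : ℝ =>
      (F.D x ^ 2 + η ^ 2) ^ ((q - 2) / 4 - 1) * ((2 * ((q - 2) / 4) + 1) * F.D x ^ 2 + η ^ 2) * F.D.D x :=
    ((((h1.pow 2).add continuous_const).rpow_const fun s => Or.inl (hw s).ne').mul (by fun_prop)).mul h2
  have hHc : Continuous fun s : ℝ => (F.D s ^ 2 + η ^ 2) ^ ((q - 2) / 4) * F.D s :=
    (((h1.pow 2).add continuous_const).rpow_const fun s => Or.inl (hw s).ne').mul h1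
  have hper : Function.Periodic (fun s : ℝ => (F.D s ^ 2 + η ^ 2) ^ ((q - 2) / 4) * F.D s + m) 1 := fun s => by
    simp only [F.D.periodic s]
  have hCWm := hCW _ _ hH hH'c hper (by unfold powMean powMeanIntegrand at hm0; exact hm0)
  have eH : ∫ s in (0 : ℝ)..1, ((F.D s ^ 2 + η ^ 2) ^ ((q - 2) / 4) * F.D s) ^ 2 =
      ∫ s in (0 : ℝ)..1, (F.D s ^ 2 + η ^ 2) ^ ((q - 2) / 2) * F.D s ^ 2 :=
    intervalIntegral.integral_congr fun s _ => by
      rw [mul_pow, ← rpow_two ((F.D s ^ 2 + η ^ 2) ^ ((q - 2) / 4)), ← rpow_mul (hw s).le,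
        show (q - 2) / 4 * 2 = (q - 2) / 2 by ring]
  have hlow : ∫ s in (0 : ℝ)..1, ((1 - ε) * ((F.D s ^ 2 + η ^ 2) ^ ((q - 2) / 4) * F.D s) ^ 2 - ε) ≤
      ∫ s in (0 : ℝ)..1, ((F.D s ^ 2 + η ^ 2) ^ ((q - 2) / 4) * F.D s + m) ^ 2 :=
    intervalIntegral.integral_mono_on zero_le_one
      (((continuous_const.mul (hHc.pow 2)).sub continuous_const).intervalIntegrable _ _)
      (((hHc.add continuous_const).pow 2).intervalIntegrable _ _) fun s _ => by
        have ha := abs_le.1 hmε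
        nlinarith [sq_nonneg (|(F.D s ^ 2 + η ^ 2) ^ ((q - 2) / 4) * F.D s| - 1), sq_nonneg m,
          abs_mul_abs_self ((F.D s ^ 2 + η ^ 2) ^ ((q - 2) / 4) * F.D s),
          neg_abs_le (((F.D s ^ 2 + η ^ 2) ^ ((q - 2) / 4) * F.D s) * m),
          abs_mul ((F.D s ^ 2 + η ^ 2) ^ ((q - 2) / 4) * F.D s) m,
          abs_nonneg ((F.D s ^ 2 + η ^ 2) ^ ((q - 2) / 4) * F.D s), abs_nonneg m]
  have hi1 : IntervalIntegrable (fun s : ℝ => (1 - ε) * ((F.D s ^ 2 + η ^ 2) ^ ((q - 2) / 4) * F.D s) ^ 2)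
      volume 0 1 := (continuous_const.mul (hHc.pow 2)).intervalIntegrable _ _
  have hi2 : IntervalIntegrable (fun _ : ℝ => ε) volume 0 1 := continuous_const.intervalIntegrable _ _
  rw [intervalIntegral.integral_sub hi1 hi2, intervalIntegral.integral_const_mul, intervalIntegral.integral_const,
    sub_zero, one_smul, eH] at hlow
  have hcmp : ∫ x in (0 : ℝ)..1,
      ((F.D x ^ 2 + η ^ 2) ^ ((q - 2) / 4 - 1) * ((2 * ((q - 2) / 4) + 1) * F.D x ^ 2 + η ^ 2) * F.D.D x) ^ 2 ≤
      ∫ x in (0 : ℝ)..1, q ^ 2 / (4 * (q - 1)) *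
        ((F.D x ^ 2 + η ^ 2) ^ ((q - 2) / 2 - 1) * ((2 * ((q - 2) / 2) + 1) * F.D x ^ 2 + η ^ 2) * F.D.D x ^ 2) := by
    have hφc : Continuous fun x : ℝ =>
        (F.D x ^ 2 + η ^ 2) ^ ((q - 2) / 2 - 1) * ((2 * ((q - 2) / 2) + 1) * F.D x ^ 2 + η ^ 2) * F.D.D x ^ 2 :=
      ((((h1.pow 2).add continuous_const).rpow_const fun s => Or.inl (hw s).ne').mul (by fun_prop)).mul (h2.pow 2)
    exact intervalIntegral.integral_mono_on zero_le_one ((hH'c.pow 2).intervalIntegrable _ _)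
      ((continuous_const.mul hφc).intervalIntegrable _ _) fun x _ => reg_deriv_sq_le hq hη.ne' (F.D x) (F.D.D x)
  rw [intervalIntegral.integral_const_mul] at hcmp
  have hIBP := regPairing_eq_neg_integral F hη.ne' q
  have h4 : 0 < 4 * (q - 1) := by linarith
  have key := (mul_le_mul_of_nonneg_left hlow (by positivity : (0 : ℝ) ≤ 4 * π ^ 2)).trans (hCWm.trans hcmp)
  rw [hIBP, neg_neg]
  have e : q / (4 * (q - 1)) * (q * ∫ x in (0 : ℝ)..1, (F.D x ^ 2 + η ^ 2) ^ ((q - 2) / 2 - 1) *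
      ((2 * ((q - 2) / 2) + 1) * F.D x ^ 2 + η ^ 2) * F.D.D x ^ 2) = q ^ 2 / (4 * (q - 1)) *
      ∫ x in (0 : ℝ)..1, (F.D x ^ 2 + η ^ 2) ^ ((q - 2) / 2 - 1) *
        ((2 * ((q - 2) / 2) + 1) * F.D x ^ 2 + η ^ 2) * F.D.D x ^ 2 := by ring
  rwa [e]

/-- **The laminate line inequality under `ConstrainedWirtinger q`** (`q > 1`):
`(16π²(q−1)/q)·∫₀¹|F′|^q ≤ −regPairing F q 0 0` (`η → 0⁺`, then `ε → 0⁺`). [ours] -/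
theorem laminate_line_coercive_of_constrainedWirtinger {q : ℝ} (hCW : ConstrainedWirtinger q) (hq : 1 < q) :
    16 * π ^ 2 * (q - 1) / q * ∫ s in (0 : ℝ)..1, |F.D s| ^ q ≤ -regPairing F q 0 0 := by
  have h1 := F.D.continuous
  have hq0 : (0 : ℝ) < q := by linarith
  have h4 : 0 < 4 * (q - 1) := by linarith
  have hA : Continuous fun η : ℝ => ∫ s in (0 : ℝ)..1, (F.D s ^ 2 + η ^ 2) ^ ((q - 2) / 2) * F.D s ^ 2 := by
    have hint : Continuous fun p : ℝ × ℝ => (F.D p.2 ^ 2 + p.1 ^ 2) ^ ((q - 2) / 2) * F.D p.2 * F.D p.2 :=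
      ((continuous_sqReg_mul (b := (q - 2) / 2) (by linarith)).comp
        (continuous_fst.prodMk (h1.comp continuous_snd))).mul (h1.comp continuous_snd)
    have h : Continuous fun η : ℝ => ∫ s in (0 : ℝ)..1, (F.D s ^ 2 + η ^ 2) ^ ((q - 2) / 2) * F.D s * F.D s :=
      intervalIntegral.continuous_parametric_intervalIntegral_of_continuous'
        (f := fun (η s : ℝ) => (F.D s ^ 2 + η ^ 2) ^ ((q - 2) / 2) * F.D s * F.D s) hint 0 1
    exact h.congr fun η => intervalIntegral.integral_congr fun s _ => by ring
  have hB : Continuous fun η : ℝ => regPairing F q η 0 := continuous_regPairing_left F hq 0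
  have e0 : ∫ s in (0 : ℝ)..1, (F.D s ^ 2 + (0 : ℝ) ^ 2) ^ ((q - 2) / 2) * F.D s ^ 2 = ∫ s in (0 : ℝ)..1, |F.D s| ^ q :=
    intervalIntegral.integral_congr fun s _ => by
      simp only [ne_eq, OfNat.ofNat_ne_zero, not_false_eq_true, zero_pow, add_zero]
      exact sq_rpow_mul_sq (F.D s) (by linarith)
  have hε_ineq : ∀ ε : ℝ, 0 < ε →
      4 * π ^ 2 * ((1 - ε) * (∫ s in (0 : ℝ)..1, |F.D s| ^ q) - ε) ≤ q / (4 * (q - 1)) * -regPairing F q 0 0 := by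
    intro ε hε
    obtain ⟨η₀, hη₀, h⟩ := reg_laminate_coercive_of_constrainedWirtinger F hCW hq hε
    have key := le_of_forall_small_pos (A := 0)
      (B := fun η : ℝ => q / (4 * (q - 1)) * -regPairing F q η 0 -
        4 * π ^ 2 * ((1 - ε) * (∫ s in (0 : ℝ)..1, (F.D s ^ 2 + η ^ 2) ^ ((q - 2) / 2) * F.D s ^ 2) - ε))
      ((continuous_const.mul hB.neg).sub (continuous_const.mul
        ((continuous_const.mul hA).sub continuous_const))).continuousAt hη₀
      fun η hη hηη₀ => sub_nonneg.2 (h η hη hηη₀)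
    have h0 := sub_nonneg.1 key
    rwa [e0] at h0
  have key := const_le_of_forall_pos_le (A := 0)
    (B := fun ε : ℝ => q / (4 * (q - 1)) * -regPairing F q 0 0 -
      4 * π ^ 2 * ((1 - ε) * (∫ s in (0 : ℝ)..1, |F.D s| ^ q) - ε))
    (by fun_prop : Continuous fun ε : ℝ => q / (4 * (q - 1)) * -regPairing F q 0 0 -
      4 * π ^ 2 * ((1 - ε) * (∫ s in (0 : ℝ)..1, |F.D s| ^ q) - ε)).continuousAt
    fun ε hε _ => sub_nonneg.2 (hε_ineq ε hε)
  have h0 := sub_nonneg.1 key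
  simp only [sub_zero, one_mul] at h0
  rw [div_mul_eq_mul_div, le_div_iff₀ h4] at h0
  rw [div_mul_eq_mul_div, div_le_iff₀ hq0]
  nlinarith [h0]

/-! ## 5. The laminate class at the rate `16π²(q−1)/q` under `ConstrainedWirtinger q` -/

/-- **CONDITIONAL LAMINATE COERCIVITY AT RATE `16π²(q−1)/q`** (`1 < q`): `ConstrainedWirtinger q →
(16π²(q−1)/q)·Φ_q(u_F) ≤ heatDissipation Φ_q u_F` for every smooth `1`-periodic `F`, both cores. [ours] -/
theorem laminate_coercive_of_constrainedWirtinger {q : ℝ} (hCW : ConstrainedWirtinger q) (hq : 1 < q) :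
    16 * π ^ 2 * (q - 1) / q * torusTopEigMoment q (lamU F) ≤ heatDissipation (torusTopEigMoment q) (lamU F) ∧
      16 * π ^ 2 * (q - 1) / q * torusNegBotEigMoment q (lamU F) ≤
        heatDissipation (torusNegBotEigMoment q) (lamU F) := by
  have hq0 : (0 : ℝ) < q := by linarith
  have hc : 0 < (1 / 2 : ℝ) ^ q := rpow_pos_of_pos (by norm_num) q
  obtain ⟨hΦ1, hΦ2⟩ : torusTopEigMoment q (lamU F) = (1 / 2 : ℝ) ^ q * ∫ s in (0 : ℝ)..1, |F.D s| ^ q ∧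
      torusNegBotEigMoment q (lamU F) = (1 / 2 : ℝ) ^ q * ∫ s in (0 : ℝ)..1, |F.D s| ^ q := by
    simpa only [zero_smul, add_zero, zero_mul] using topEigMoment_line_half F 0 hq0
  obtain ⟨hD1, hD2⟩ := heatDissipation_lamU_eq_neg_regPairing F hq
  have key : 16 * π ^ 2 * (q - 1) / q * ((1 / 2 : ℝ) ^ q * ∫ s in (0 : ℝ)..1, |F.D s| ^ q) ≤
      -((1 / 2 : ℝ) ^ q * regPairing F q 0 0) := by
    have h := mul_le_mul_of_nonneg_left (laminate_line_coercive_of_constrainedWirtinger F hCW hq) hc.le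
    calc 16 * π ^ 2 * (q - 1) / q * ((1 / 2 : ℝ) ^ q * ∫ s in (0 : ℝ)..1, |F.D s| ^ q)
          = (1 / 2 : ℝ) ^ q * (16 * π ^ 2 * (q - 1) / q * ∫ s in (0 : ℝ)..1, |F.D s| ^ q) := by ring
      _ ≤ (1 / 2 : ℝ) ^ q * -regPairing F q 0 0 := h
      _ = -((1 / 2 : ℝ) ^ q * regPairing F q 0 0) := by ring
  exact ⟨by rw [hΦ1, hD1]; exact key, by rw [hΦ2, hD2]; exact key⟩

/-- **CONDITIONAL CLASS FORM**: `ConstrainedWirtinger q → HeatCoerciveOn IsX2Laminate Φ_q (16π²(q−1)/q)`, both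
cores, every real `q > 1` (vocabulary of `TopEigHeatCoerciveGap`). The hypothesis is discharged for every `q > 0`
in the sequel `NoGo/TopEigHeatLaminateUnconditional`, which states this class form with no hypothesis; the kernel
floor proved before it is K37b's `4π²(q−1)/q`. [ours] -/
theorem heatCoerciveOn_laminate_of_constrainedWirtinger {q : ℝ} (hCW : ConstrainedWirtinger q) (hq : 1 < q) :
    HeatCoerciveOn (d := Fin 3) IsX2Laminate (torusTopEigMoment q) (16 * π ^ 2 * (q - 1) / q) ∧
      HeatCoerciveOn (d := Fin 3) IsX2Laminate (torusNegBotEigMoment q) (16 * π ^ 2 * (q - 1) / q) :=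
  ⟨by rintro - v - - - ⟨F, rfl⟩; exact (laminate_coercive_of_constrainedWirtinger F hCW hq).1,
    by rintro - v - - - ⟨F, rfl⟩; exact (laminate_coercive_of_constrainedWirtinger F hCW hq).2⟩

/-- **CONDITIONAL KILL FORM**: under `ConstrainedWirtinger q`, a kill witness for L-λ(q) (`q > 1`) at any rate
`c ≤ 16π²(q−1)/q` is NOT an `x₂`-laminate (either core). [ours] -/
theorem kill_not_laminate_of_constrainedWirtinger {q : ℝ} (hCW : ConstrainedWirtinger q) (hq : 1 < q) {c : ℝ}
    (hc : c ≤ 16 * π ^ 2 * (q - 1) / q) {v : UnitAddTorus (Fin 3) → EuclideanSpace ℝ (Fin 3)}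
    (hv : heatDissipation (torusTopEigMoment q) v < c * torusTopEigMoment q v ∨
      heatDissipation (torusNegBotEigMoment q) v < c * torusNegBotEigMoment q v) : ¬ IsX2Laminate v := by
  rintro ⟨F, rfl⟩
  obtain ⟨h1, h2⟩ := laminate_coercive_of_constrainedWirtinger F hCW hq
  rcases hv with hv | hv
  · exact not_lt.2 ((mul_le_mul_of_nonneg_right hc (torusTopEigMoment_nonneg q (lamU F))).trans h1) hv
  · exact not_lt.2 ((mul_le_mul_of_nonneg_right hc (torusNegBotEigMoment_nonneg q (lamU F))).trans h2) hv

/-! ## 6. Consistency at `q = 2`: the hypothesis HOLDS there (classical Wirtinger, tree) -/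

/-- **`ConstrainedWirtinger 2` holds**: at `q = 2` the constraint reads `∫₀¹ u = 0` (`(u²)^0 = 1`) and the
inequality is the classical Wirtinger inequality for `C¹` `u` with `u(1) = u(0)` — tree
`Literature.Analysis.FluidPDE.wirtinger_interval_real` on `[0, 1]`. Through `laminate_coercive_of_constrainedWirtinger`
this re-derives the sharp tree value `8π²` of `TopEigLaminateTwo.laminate_rigid_two` (consistency of the typing;
for `q ≠ 2` the hypothesis is proved in the sequel, not here). [folklore: Wirtinger; tree `wirtinger_interval_real`] -/
theorem constrainedWirtinger_two : ConstrainedWirtinger 2 := by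
  intro u u' hd hc hp h0
  have e : (fun x : ℝ => (u x ^ 2) ^ ((1 : ℝ) / 2 - 1 / 2) * u x) = fun x => u x := by
    funext x; rw [sub_self, rpow_zero, one_mul]
  rw [e] at h0
  have h := Literature.Analysis.FluidPDE.wirtinger_interval_real zero_lt_one hd hc (by simpa using hp 0) h0
  have e2 : (2 * π / (1 - 0 : ℝ)) ^ 2 = 4 * π ^ 2 := by ring
  rwa [e2] at h

end TopEigLaminate

end Summit.NavierStokesRegularity.FunctionalMining
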